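import Summits.Ventures.DiscreteObjects.Hadamard.PrimeSquareOrder
import Summits.Ventures.DiscreteObjects.Hadamard.ElemAbelianRank2_7

/-!
# Hadamard 668 census, family F12 — the free-orbit bound for a cyclic group of odd order, and the STRUCTURE of a
# (hypothetical) automorphism of order 49 of an H(668) (kernel)

Framing: lottery ticket; floor = certified bounds/negative ranges.

Cell pub-namedobj (venture DiscreteObjects), target (H), hadamard gen 17.  Order `49` is the one `7`-power left open by
`PrimeCubeOrder7` / `ElemAbelianSummary668C` (counting allows `668 = 80 + 49·12`).  This file records what IS forced.
* `cyclic_free_orbit_bound` (general): a signed automorphism `(π, κ, d, e)` of a Hadamard matrix of order `n` with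
  `π^N = κ^N = 1`, `N` odd, and a row `x₁` of `π`-period exactly `N` (`π^j x₁ ≠ x₁`, `0 < j < N`) has
  `N · #Fix(κ) ≤ n`: after re-signing (`exists_resign_of_odd`) every `κ`-fixed column is constant along the `N` distinct
  rows `π^k x₁` (`card_mul_card_le_of_signed_cols`).  (For `N = p` prime this is the trivial `p·f ≤ n`; the point is
  composite `N`.)
* **`hadamard668_order49_structure`**: if `π^49 = κ^49 = 1` and `(π^7, κ^7) ≠ (1, 1)` then `π^7` and `κ^7` fix EXACTLY
  `80` rows / columns (`census7` window `{24, …, 80}` and `49 ∣ #moved(κ^7)` by `sq_dvd_card_moved`: only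
  `668 − 80 = 588 = 49·12`), and `π`, `κ` themselves fix `3` or `10` rows / columns (a row moved by `π^7` has
  `π`-period `49` — `free_of_moved_pow` —, so `49·#Fix(κ) ≤ 668`, `#Fix(κ) ≤ 13`, and `#Fix(κ) ≡ 668 ≡ 3 (mod 7)` by
  `Equiv.Perm.card_compl_support_modEq`; rows by the transpose).  On paper the orbit identity (E3) of
  FAMILY-F12-G16 §3 (two `π`-fixed rows are orthogonal: `ε₀ + 7ε₁ + 49ε₂ = 0` with `ε₀` odd and `|ε₀| ≤ 3` if only
  `3` columns were fixed) removes `3`, leaving `10 + 10` — not claimed in the kernel.  No exclusion; ours; no `sorry`.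
-/

namespace Summit.Ventures.DiscreteObjects.Hadamard

open Finset BigOperators Matrix

open Literature.Combinatorics.Designs.GoethalsSeidel (IsHadamardMatrix)

variable {ι : Type*} [Fintype ι] [DecidableEq ι]

/-- **free-orbit bound for a cyclic group of odd order `N`**: a row of `π`-period exactly `N` forces
`N · #{y : κ y = y} ≤ n`. -/
theorem cyclic_free_orbit_bound {H : Matrix ι ι ℤ} (hH : IsHadamardMatrix H) {π κ : Equiv.Perm ι} {d e : ι → ℤ}
    (haut : IsSignedAut H π κ d e) {N : ℕ} (hodd : Odd N) (hπ : π ^ N = 1) (hκ : κ ^ N = 1) (x₁ : ι)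
    (hfree : ∀ j, 0 < j → j < N → (π ^ j) x₁ ≠ x₁) :
    N * (univ.filter fun y => κ y = y).card ≤ Fintype.card ι := by
  classical
  obtain ⟨s, t', hs, ht', hH1, hinv1⟩ := exists_resign_of_odd hH haut hodd hπ hκ
  set H₁ : Matrix ι ι ℤ := Matrix.of fun i j => s i * t' j * H i j with hH₁def
  have hH1aut : ∀ i j, H₁ (π i) (κ j) = H₁ i j := by
    intro i j; simp only [hH₁def, Matrix.of_apply]; exact hinv1 i j
  -- the N rows π^k x₁ are distinct
  have hinj : Function.Injective (fun k : Fin N => (π ^ (k : ℕ)) x₁) := by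
    intro k l hkl
    simp only at hkl
    apply Fin.ext
    by_contra hne
    rcases Nat.lt_or_gt_of_ne hne with hlt | hlt
    · have e1 : (π ^ (k : ℕ)) ((π ^ ((l : ℕ) - k)) x₁) = (π ^ (k : ℕ)) x₁ := by
        rw [← Equiv.Perm.mul_apply, ← pow_add, show (k : ℕ) + ((l : ℕ) - k) = l by omega]; exact hkl.symm
      exact hfree _ (by omega) (by omega) ((π ^ (k : ℕ)).injective e1)
    · have e1 : (π ^ (l : ℕ)) ((π ^ ((k : ℕ) - l)) x₁) = (π ^ (l : ℕ)) x₁ := by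
        rw [← Equiv.Perm.mul_apply, ← pow_add, show (l : ℕ) + ((k : ℕ) - l) = k by omega]; exact hkl
      exact hfree _ (by omega) (by omega) ((π ^ (l : ℕ)).injective e1)
  -- κ-fixed columns are constant along the π-orbit
  have hstep : ∀ (m : ℕ) (y : ι), κ y = y → H₁ ((π ^ m) x₁) y = H₁ x₁ y := by
    intro m y hy
    induction m with
    | zero => simp
    | succ m ih =>
      have e1 := hH1aut ((π ^ m) x₁) y
      rw [hy] at e1
      rw [pow_succ', Equiv.Perm.mul_apply, e1, ih]
  have hconst : ∀ y ∈ (univ.filter fun y => κ y = y), ∀ k : Fin N,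
      H₁ ((fun k : Fin N => (π ^ (k : ℕ)) x₁) k) y = (fun _ : Fin N => (1 : ℤ)) k * H₁ x₁ y := by
    intro y hy k
    simp only [Finset.mem_filter, Finset.mem_univ, true_and] at hy
    simp only [one_mul]
    exact hstep k y hy
  have h := card_mul_card_le_of_signed_cols hH1 (fun k : Fin N => (π ^ (k : ℕ)) x₁) hinj (fun _ => 1)
    (fun _ => Or.inl rfl) (univ.filter fun y => κ y = y) (fun y => H₁ x₁ y) (fun y _ => hH1.1 x₁ y) hconst
  rw [Fintype.card_fin] at h
  exact h

section order49
variable {H : Matrix ι ι ℤ}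

/-- half of the structure statement: columns (the rows follow by transposition) -/
lemma order49_cols (hH : IsHadamardMatrix H) (hι : Fintype.card ι = 668)
    {π κ : Equiv.Perm ι} {d e : ι → ℤ} (haut : IsSignedAut H π κ d e)
    (hπ : π ^ 49 = 1) (hκ : κ ^ 49 = 1) (hπ7 : π ^ 7 ≠ 1) :
    (univ.filter fun j => (κ ^ 7) j = j).card = 80 ∧
      ((univ.filter fun j => κ j = j).card = 3 ∨ (univ.filter fun j => κ j = j).card = 10) := by
  classical
  haveI hp7 : Fact (Nat.Prime 7) := ⟨by norm_num⟩
  have haut7 := isSignedAut_pow haut 7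
  have hπ77 : (π ^ 7) ^ 7 = 1 := by rw [← pow_mul]; exact hπ
  have hκ77 : (κ ^ 7) ^ 7 = 1 := by rw [← pow_mul]; exact hκ
  obtain ⟨hcC, hcR⟩ := census7 hH hι haut7 hπ77 hκ77 hπ7
  -- 49 ∣ #moved(κ^7): only 588 = 49·12 fits the window
  have hκ' : κ ^ (7 * 7) = 1 := hκ
  have hπ' : π ^ (7 * 7) = 1 := hπ
  have hdvdC := sq_dvd_card_moved κ (by norm_num : (7 : ℕ).Prime) hκ'
  have hsplitC := Finset.card_filter_add_card_filter_not (s := (univ : Finset ι)) (fun j => (κ ^ 7) j = j)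
  rw [Finset.card_univ, hι] at hsplitC
  have eC : (univ.filter fun j => (κ ^ 7) j ≠ j) = univ.filter fun j => ¬ (κ ^ 7) j = j := rfl
  rw [eC] at hdvdC
  obtain ⟨c, hc⟩ := hdvdC
  have f80C : (univ.filter fun j => (κ ^ 7) j = j).card = 80 := by omega
  refine ⟨f80C, ?_⟩
  -- a row moved by π^7 has π-period 49
  have hdvdR := sq_dvd_card_moved π (by norm_num : (7 : ℕ).Prime) hπ'
  have hsplitR := Finset.card_filter_add_card_filter_not (s := (univ : Finset ι)) (fun i => (π ^ 7) i = i)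
  rw [Finset.card_univ, hι] at hsplitR
  have eR : (univ.filter fun i => (π ^ 7) i ≠ i) = univ.filter fun i => ¬ (π ^ 7) i = i := rfl
  rw [eR] at hdvdR
  obtain ⟨c', hc'⟩ := hdvdR
  have hpos : 0 < (univ.filter fun i => ¬ (π ^ 7) i = i).card := by omega
  obtain ⟨x₁, hx₁⟩ := Finset.card_pos.mp hpos
  simp only [Finset.mem_filter, Finset.mem_univ, true_and] at hx₁
  have hfree := free_of_moved_pow π (by norm_num : (7 : ℕ).Prime) hπ' hx₁
  have hbound := cyclic_free_orbit_bound hH haut (by decide : Odd (7 * 7)) hπ' hκ' x₁ hfree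
  rw [hι] at hbound
  -- #Fix(κ) ≡ 668 (mod 7)
  have hm := Equiv.Perm.card_compl_support_modEq (p := 7) (n := 2) (σ := κ) hκ
  have eS : κ.supportᶜ = univ.filter fun x => κ x = x := by
    ext x; simp [Equiv.Perm.mem_support]
  rw [eS, hι] at hm
  unfold Nat.ModEq at hm
  omega

/-- **structure of an automorphism of order 49 of an H(668)**: for a signed automorphism `(π, κ, d, e)` with
`π^49 = κ^49 = 1` and `(π^7, κ^7) ≠ (1, 1)`: `π^7` and `κ^7` fix exactly `80` rows / columns, and `π`, `κ` fix `3` or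
`10` rows / columns. -/
theorem hadamard668_order49_structure (hH : IsHadamardMatrix H) (hι : Fintype.card ι = 668)
    (π κ : Equiv.Perm ι) (d e : ι → ℤ) (haut : IsSignedAut H π κ d e)
    (hπ : π ^ 49 = 1) (hκ : κ ^ 49 = 1) (hne : π ^ 7 ≠ 1 ∨ κ ^ 7 ≠ 1) :
    (univ.filter fun i => (π ^ 7) i = i).card = 80 ∧ (univ.filter fun j => (κ ^ 7) j = j).card = 80 ∧
    ((univ.filter fun i => π i = i).card = 3 ∨ (univ.filter fun i => π i = i).card = 10) ∧
    ((univ.filter fun j => κ j = j).card = 3 ∨ (univ.filter fun j => κ j = j).card = 10) := by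
  have hcard : (Fintype.card ι : ℤ) ≠ 0 := by rw [hι]; norm_num
  have hHt : IsHadamardMatrix Hᵀ := isHadamard_transpose hH hcard
  have haut7 := isSignedAut_pow haut 7
  have hπ77 : (π ^ 7) ^ 7 = 1 := by rw [← pow_mul]; exact hπ
  have hκ77 : (κ ^ 7) ^ 7 = 1 := by rw [← pow_mul]; exact hκ
  -- both seventh powers are nontrivial
  have hπ7 : π ^ 7 ≠ 1 := by
    rcases hne with h | h
    · exact h
    · intro h7; apply h; rw [h7] at haut7
      exact signedAut_snd_eq_one H hH hcard haut7 (by decide : Odd 7) hκ77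
  have hκ7 : κ ^ 7 ≠ 1 := by
    intro h7; apply hπ7
    have ht := isSignedAut_transpose haut7
    rw [h7] at ht
    exact signedAut_snd_eq_one Hᵀ hHt hcard ht (by decide : Odd 7) hπ77
  obtain ⟨f80C, hC⟩ := order49_cols hH hι haut hπ hκ hπ7
  obtain ⟨f80R, hR⟩ := order49_cols hHt hι (isSignedAut_transpose haut) hκ hπ hκ7
  exact ⟨f80R, f80C, hR, hC⟩

end order49

end Summit.Ventures.DiscreteObjects.Hadamard
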